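import Summits.HodgeConjecture.HodgeConjecture.Theorems.F0P6bWeilCartierDuality   -- ★ twin of ED. 4 1c9a4bbec4094740 (re-homed, LEAD «M-72»∕«M-79»; Theorems lane, namespace KEPT; dealer∕pen LA7-plan (g4) #8A∕B∕C)
import HarnessLib

/-! # F0_P6b_WeilCartierDuality — ED. 5 = SHIM (re-home, IMPORT-ONLY).  The W-line's declarations now live, under the SAME fully-qualified names
(namespace `Summit.HodgeConjecture.HodgeConjecture.Cruxes.HLiu418.F0P6bWeilCartierDuality` kept), in ★ `Theorems/F0P6bWeilCartierDualityLetters.lean` (§0–§2),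
★ `Theorems/F0P6bWeilCartierDualityHead.lean` (§3–§4) and ★ `Theorems/F0P6bWeilCartierDuality.lean` (§5–§6, transitively all) — the tree bytes of ED. 4 split by the
size lint, 0 code bytes changed; this file only imports the last, so the module `…Cruxes.HLiu418.Lines.F0_P6b_WeilCartierDuality` keeps serving every name to any
importer (tree importers after P6b BATCH-1: none — the W-DOCK ED. 5 imports the ★ directly).  It declares nothing.  Edition history ED. 1–4 stays in the line card
and in git; future changes to the W-line are ★-side proposals.  HC_CM is proved only modulo the 7 printed citations (2 remaining named inputs) until rung 0 closes;
count-neutral (0 `sorry`, 0 socket, 0 declaration). -/
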